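import Summits.Ventures.LatticeQCDFlow.Exactness.IMHTauIntInfiniteOfWeightMoment
import Summits.Ventures.LatticeQCDFlow.Exactness.IMHTauIntLeInvESS
import Summits.Ventures.LatticeQCDFlow.Exactness.IMHAcceptanceGeESS
import HarnessLib

/-!
# `1/κ − ½ ≤ τ_int ≤ ½ + 12/κ` for every balanced sign observable of the flow sampler

HONEST FRAMING: exact (Metropolis-corrected) sampling algorithms for lattice gauge theory;
figures of merit are autocorrelation/cost numbers at stated couplings and volumes; no
continuum-physics claim.  (SCALAR calibration rung S0-A: not a gauge result.)

Venture `LatticeQCDFlow` (cell pub-lqcd), topic `Exactness`; FANOUT row 2 (`s0-phi4`, FLOW arm).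
NEW WORK of the cell: a lower companion to `IMHTauIntLeInvESS.lean`.  From the exact formula
`τ_int = ½ + (I + J)/∫ g² w` (`IMHTauIntExact`) with `I ≥ 0` and the rejection-odds floor
`λ(b)/(1 − λ(b)) ≥ b/Z − 1` (`IMHTauIntInfiniteOfWeightMoment.rejOdds_ge`): the `g²`-weighted mean
importance weight is a floor under `τ_int`, and for SIGN observables (`g² = 1`) that mean is
exactly the inverse Kish fraction `1/κ = W₂/Z²`.  Nothing is cited as a fact.

## What is proved (`w, q > 0` measurable integrable, `∫ q = 1`, `Z = ∫ w`, `b = w/q`,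
`W₂ = ∫ b w dμ < ∞`, `κ = Z²/W₂`; `g` measurable, `|g| ≤ B`, centred)

* **`imhOp_tauInt_ge_weightMean`** — `τ_int(g) ≥ (∫ g² b w dμ)/(Z ∫ g² w dμ) − ½`: the
  `g²`-weighted mean of the normalised importance weight `b/Z` bounds `τ_int` from below;
* **`imhOp_sign_tauInt_sandwich`** — for every measurable `g` with `g² = 1` and `∫ g w = 0`
  (a balanced sign observable, e.g. `1_A − 1_{Aᶜ}` with `π(A) = ½`):
  `W₂/Z² − ½ ≤ τ_int(g) ≤ ½ + 12 W₂/Z²`, i.e. `1/κ − ½ ≤ τ_int ≤ ½ + 12/κ`;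
* `overlap_inv_le`, **`imhOp_sign_tauInt_ge_of_overlap`**,
  **`imhOp_sign_tauInt_ge_of_meanAccept`** — with
  `m = ∫ min(w/Z, q) = 1 − TV` the model–target overlap and `ā` the equilibrium acceptance
  (`IMHAcceptanceGeESS`: `1/κ ≥ 1/m − 1`; `FlowAcceptanceOverlap`: `m² ≤ ā`):
  `τ_int(g) ≥ 1/m − 3/2 = TV/(1 − TV) − ½` and `τ_int(g) ≥ 1/√ā − 3/2` for every balanced sign
  observable (square-integrable weights);
* the lattice (row 2's `imhOpPhi4 J λ q̃`, `g = f − ⟨f⟩` with `(f − ⟨f⟩)² = 1`):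
  **`phi4Flow_sign_tauInt_sandwich`**.

Reading for S0-A (no numerics implied): for the flow arm the inverse ESS fraction of the raw
importance sampler IS the integrated autocorrelation time of every balanced sign observable of
the exact chain, up to the constants `(1, 12)` and the additive `½` — the two figures of merit of
the cell's fitness (ESS-per-cost, `τ_int`-per-cost) are certified proxies of each other on this
class.  NOT CLAIMED: sharp constants; observables with non-constant `g²` beyond the weighted-mean
floor; HMC / local Metropolis; any number for a trained network.
-/

namespace Summit.Ventures.LatticeQCDFlow.Exactness

open Real MeasureTheory Filter Set Topology
open Summit.Ventures.LatticeQCDFlow.Scoring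

variable {X : Type*} [MeasurableSpace X] {μ : Measure X} {w q : X → ℝ}

variable [SFinite μ]

/-- **`τ_int(g) ≥ E_{g²w}[b]/Z / E[g²w]... − ½`**: precisely, for a bounded centred observable of
the exact flow sampler with square-integrable weights,
`(∫ g² b w dμ) / (Z ∫ g² w dμ) − ½ ≤ τ_int(g)`
(`τ = ½ + (I + J)/∫g²w`, `I ≥ 0`, `J ≥ ∫ g² w (b/Z − 1)`). -/
theorem imhOp_tauInt_ge_weightMean (hw0 : ∀ t, 0 < w t) (hwm : Measurable w)
    (hwi : Integrable w μ) (hq0 : ∀ t, 0 < q t) (hqm : Measurable q) (hqi : Integrable q μ)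
    (hq1 : ∫ z, q z ∂μ = 1) (hW₂ : Integrable (fun x => w x / q x * w x) μ) {g : X → ℝ}
    (hgm : Measurable g) {B : ℝ} (hgb : ∀ t, |g t| ≤ B) (hg0 : ∫ x, g x * w x ∂μ = 0) :
    (∫ x, g x ^ 2 * (w x / q x * w x) ∂μ) / ((∫ x, w x ∂μ) * ∫ x, g x ^ 2 * w x ∂μ) - 1 / 2
      ≤ tauInt (fun k => (∫ x, g x * ((imhOp μ w q)^[k] g) x * w x ∂μ)
          / ∫ x, g x ^ 2 * w x ∂μ) := by
  set Z : ℝ := ∫ x, w x ∂μ with hZdef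
  set A : ℝ := ∫ x, g x ^ 2 * w x ∂μ with hAdef
  have hZ : 0 < Z := integral_pos_of_pos hw0 hwi hq1
  have hA0 : 0 ≤ A := integral_nonneg fun x => mul_nonneg (sq_nonneg _) (hw0 x).le
  have hb0 : ∀ x, 0 < w x / q x := fun x => div_pos (hw0 x) (hq0 x)
  obtain ⟨hI, -⟩ := levelFunctional_le hw0 hwm hwi hq0 hqm hqi hq1 hW₂ hgm hgb hg0 one_pos
  obtain ⟨hJ, -⟩ := stickFunctional_le hw0 hwm hwi hq0 hqm hqi hq1 hW₂ hgm hgb one_pos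
  rw [imhOp_tauInt_eq hw0 hwm hwi hq0 hqm hqi hq1 hgm hgb hI hJ]
  -- `I ≥ 0`
  have hI0 : 0 ≤ ∫ u in Ioi (0:ℝ), (∫ x, (if w x / q x < u then g x * w x else 0) ∂μ) ^ 2
      / (u * (1 - rejCurve μ w q u)) ^ 2 :=
    setIntegral_nonneg measurableSet_Ioi fun u _ => div_nonneg (sq_nonneg _) (sq_nonneg _)
  -- `J ≥ ∫ g² w (b/Z − 1) = (∫ g² b w)/Z − A`
  have hg2 : ∀ x, g x ^ 2 ≤ B ^ 2 := fun x => by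
    rw [← sq_abs]; exact pow_le_pow_left₀ (abs_nonneg _) (hgb x) 2
  have hgbw : Integrable (fun x => g x ^ 2 * (w x / q x * w x)) μ := by
    refine Integrable.mono' (hW₂.const_mul (B ^ 2)) (((hgm.pow_const 2).mul
      ((hwm.div hqm).mul hwm)).aestronglyMeasurable) (Eventually.of_forall fun x => ?_)
    have h0 : 0 ≤ w x / q x * w x := mul_nonneg (hb0 x).le (hw0 x).le
    rw [Real.norm_eq_abs, abs_of_nonneg (mul_nonneg (sq_nonneg _) h0)]
    exact mul_le_mul_of_nonneg_right (hg2 x) h0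
  have hg2w : Integrable (fun x => g x ^ 2 * w x) μ :=
    (integrable_sq_mul_weight_mul hw0 hwm hwi hgm measurable_const hgb (fun _ => zero_le_one)
      (fun _ => le_rfl)).congr (Eventually.of_forall fun x => mul_one _)
  have hJge : (∫ x, g x ^ 2 * (w x / q x * w x) ∂μ) / Z - A
      ≤ ∫ x, g x ^ 2 * w x * (rejCurve μ w q (w x / q x) / (1 - rejCurve μ w q (w x / q x))) ∂μ := by
    have e : (∫ x, g x ^ 2 * (w x / q x * w x) ∂μ) / Z - A
        = ∫ x, g x ^ 2 * w x * ((w x / q x) / Z - 1) ∂μ := by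
      have e1 : ∀ x, g x ^ 2 * w x * ((w x / q x) / Z - 1)
          = g x ^ 2 * (w x / q x * w x) / Z - g x ^ 2 * w x := fun x => by ring
      simp_rw [e1]
      rw [integral_sub (hgbw.div_const Z) hg2w, integral_div]
    rw [e]
    refine integral_mono ?_ hJ fun x => ?_
    · have e2 : (fun x => g x ^ 2 * w x * ((w x / q x) / Z - 1))
          = fun x => g x ^ 2 * (w x / q x * w x) / Z - g x ^ 2 * w x := funext fun x => by ring
      rw [e2]
      exact (hgbw.div_const Z).sub hg2w
    · exact mul_le_mul_of_nonneg_left (rejOdds_ge hw0 hwm hwi hq0 hqm hqi hq1 (hb0 x))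
        (mul_nonneg (sq_nonneg _) (hw0 x).le)
  rcases eq_or_lt_of_le hA0 with hA | hA
  · -- `A = 0`: both sides degenerate
    rw [← hAdef, ← hA, mul_zero, div_zero, div_zero, zero_sub, add_zero]
    norm_num
  · rw [sub_le_iff_le_add, div_le_iff₀ (mul_pos hZ hA)]
    have h2 : (∫ x, g x ^ 2 * (w x / q x * w x) ∂μ)
        ≤ Z * (A + ∫ x, g x ^ 2 * w x
          * (rejCurve μ w q (w x / q x) / (1 - rejCurve μ w q (w x / q x))) ∂μ) := by
      rw [div_sub' hZ.ne', div_le_iff₀ hZ] at hJge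
      linarith
    have hAne := hA.ne'
    have hZne := hZ.ne'
    calc (∫ x, g x ^ 2 * (w x / q x * w x) ∂μ)
        ≤ Z * (A + ∫ x, g x ^ 2 * w x
            * (rejCurve μ w q (w x / q x) / (1 - rejCurve μ w q (w x / q x))) ∂μ) := h2
      _ ≤ Z * (A + ((∫ u in Ioi (0:ℝ), (∫ x, (if w x / q x < u then g x * w x else 0) ∂μ) ^ 2
            / (u * (1 - rejCurve μ w q u)) ^ 2) + ∫ x, g x ^ 2 * w x
            * (rejCurve μ w q (w x / q x) / (1 - rejCurve μ w q (w x / q x))) ∂μ)) := by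
          refine mul_le_mul_of_nonneg_left ?_ hZ.le
          linarith
      _ = (1 / 2 + ((∫ u in Ioi (0:ℝ), (∫ x, (if w x / q x < u then g x * w x else 0) ∂μ) ^ 2
            / (u * (1 - rejCurve μ w q u)) ^ 2) + ∫ x, g x ^ 2 * w x
            * (rejCurve μ w q (w x / q x) / (1 - rejCurve μ w q (w x / q x))) ∂μ) / A
            + 1 / 2) * (Z * A) := by
          field_simp
          ring

/-- **THE SIGN-OBSERVABLE SANDWICH `1/κ − ½ ≤ τ_int ≤ ½ + 12/κ`.**  `w, q > 0` measurable
integrable, `∫ q = 1`, `Z = ∫ w`, `W₂ = ∫ b w dμ < ∞`, `κ = Z²/W₂`.  For every measurable `g` with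
`g² = 1` and `∫ g w = 0` (a balanced sign observable):
`W₂/Z² − ½ ≤ τ_int(g) ≤ ½ + 12 W₂/Z²`. -/
theorem imhOp_sign_tauInt_sandwich (hw0 : ∀ t, 0 < w t) (hwm : Measurable w)
    (hwi : Integrable w μ) (hq0 : ∀ t, 0 < q t) (hqm : Measurable q) (hqi : Integrable q μ)
    (hq1 : ∫ z, q z ∂μ = 1) (hW₂ : Integrable (fun x => w x / q x * w x) μ) {g : X → ℝ}
    (hgm : Measurable g) (hg1 : ∀ t, g t ^ 2 = 1) (hg0 : ∫ x, g x * w x ∂μ = 0) :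
    (∫ x, w x / q x * w x ∂μ) / (∫ x, w x ∂μ) ^ 2 - 1 / 2
      ≤ tauInt (fun k => (∫ x, g x * ((imhOp μ w q)^[k] g) x * w x ∂μ)
          / ∫ x, g x ^ 2 * w x ∂μ)
    ∧ tauInt (fun k => (∫ x, g x * ((imhOp μ w q)^[k] g) x * w x ∂μ)
          / ∫ x, g x ^ 2 * w x ∂μ)
      ≤ 1 / 2 + 12 * (∫ x, w x / q x * w x ∂μ) / (∫ x, w x ∂μ) ^ 2 := by
  have hgb : ∀ t, |g t| ≤ 1 := fun t => by
    have h := hg1 t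
    have : |g t| ^ 2 = 1 := by rw [sq_abs]; exact h
    nlinarith [abs_nonneg (g t)]
  have hA : ∫ x, g x ^ 2 * w x ∂μ = ∫ x, w x ∂μ := by
    refine integral_congr_ae (Eventually.of_forall fun x => ?_)
    show g x ^ 2 * w x = w x
    rw [hg1 x, one_mul]
  have hN : ∫ x, g x ^ 2 * (w x / q x * w x) ∂μ = ∫ x, w x / q x * w x ∂μ := by
    refine integral_congr_ae (Eventually.of_forall fun x => ?_)
    show g x ^ 2 * (w x / q x * w x) = w x / q x * w x
    rw [hg1 x, one_mul]
  constructor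
  · have h := imhOp_tauInt_ge_weightMean hw0 hwm hwi hq0 hqm hqi hq1 hW₂ hgm hgb hg0
    rw [hN] at h
    rw [hA] at h ⊢
    rw [← sq] at h
    exact h
  · have h := imhOp_tauInt_le_invESS hw0 hwm hwi hq0 hqm hqi hq1 hW₂ hgm hgb hg0
    rw [hA] at h ⊢
    rw [one_pow, mul_one, div_div, ← sq] at h
    exact h

omit [SFinite μ] in
/-- The overlap `m = ∫ min(w/Z, q)` of target and model under square-integrable weights:
`m > 0` and `1/m ≤ 1 + W₂/Z²` (`overlap_ge_of_weightMoment` for the normalised target `w/Z`). -/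
theorem overlap_inv_le (hw0 : ∀ t, 0 < w t) (hwi : Integrable w μ) (hq0 : ∀ t, 0 < q t)
    (hqi : Integrable q μ) (hq1 : ∫ z, q z ∂μ = 1)
    (hW₂ : Integrable (fun x => w x / q x * w x) μ) :
    0 < ∫ x, min (w x / ∫ z, w z ∂μ) (q x) ∂μ
    ∧ 1 / (∫ x, min (w x / ∫ z, w z ∂μ) (q x) ∂μ)
      ≤ 1 + (∫ x, w x / q x * w x ∂μ) / (∫ z, w z ∂μ) ^ 2 := by
  set Z : ℝ := ∫ z, w z ∂μ with hZdef
  have hZ : 0 < Z := integral_pos_of_pos hw0 hwi hq1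
  have hp0 : ∀ x, 0 < w x / Z := fun x => div_pos (hw0 x) hZ
  have hpi : Integrable (fun x => w x / Z) μ := hwi.div_const Z
  have hp1 : ∫ x, w x / Z ∂μ = 1 := by rw [integral_div, ← hZdef, div_self hZ.ne']
  have hWp : Integrable (fun x => (w x / Z) / q x * (w x / Z)) μ := by
    refine (hW₂.div_const (Z ^ 2)).congr (Eventually.of_forall fun x => ?_)
    show w x / q x * w x / Z ^ 2 = (w x / Z) / q x * (w x / Z)
    field_simp
  have hov := overlap_ge_of_weightMoment hp0 hpi hp1 hq0 hqi hWp
  have eW : ∫ x, (w x / Z) / q x * (w x / Z) ∂μ = (∫ x, w x / q x * w x ∂μ) / Z ^ 2 := by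
    rw [← integral_div]
    refine integral_congr_ae (Eventually.of_forall fun x => ?_)
    show (w x / Z) / q x * (w x / Z) = w x / q x * w x / Z ^ 2
    field_simp
  rw [eW] at hov
  have hWnn : 0 ≤ (∫ x, w x / q x * w x ∂μ) / Z ^ 2 :=
    div_nonneg (integral_nonneg fun x => mul_nonneg (div_nonneg (hw0 x).le (hq0 x).le) (hw0 x).le)
      (sq_nonneg _)
  have h1W : 0 < 1 + (∫ x, w x / q x * w x ∂μ) / Z ^ 2 := by linarith
  have hm0 : 0 < ∫ x, min (w x / Z) (q x) ∂μ := lt_of_lt_of_le (div_pos one_pos h1W) hov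
  refine ⟨hm0, ?_⟩
  rw [div_le_iff₀ hm0]
  have := (div_le_iff₀ h1W).1 hov
  linarith

/-- **`τ_int ≥ 1/m − 3/2 = TV/(1−TV) − ½` for balanced sign observables**, `m = ∫ min(w/Z, q)` the
overlap of model and target (square-integrable weights). -/
theorem imhOp_sign_tauInt_ge_of_overlap (hw0 : ∀ t, 0 < w t) (hwm : Measurable w)
    (hwi : Integrable w μ) (hq0 : ∀ t, 0 < q t) (hqm : Measurable q) (hqi : Integrable q μ)
    (hq1 : ∫ z, q z ∂μ = 1) (hW₂ : Integrable (fun x => w x / q x * w x) μ) {g : X → ℝ}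
    (hgm : Measurable g) (hg1 : ∀ t, g t ^ 2 = 1) (hg0 : ∫ x, g x * w x ∂μ = 0) :
    1 / (∫ x, min (w x / ∫ z, w z ∂μ) (q x) ∂μ) - 3 / 2
      ≤ tauInt (fun k => (∫ x, g x * ((imhOp μ w q)^[k] g) x * w x ∂μ)
          / ∫ x, g x ^ 2 * w x ∂μ) := by
  obtain ⟨hlow, -⟩ := imhOp_sign_tauInt_sandwich hw0 hwm hwi hq0 hqm hqi hq1 hW₂ hgm hg1 hg0
  obtain ⟨-, hinv⟩ := overlap_inv_le hw0 hwi hq0 hqi hq1 hW₂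
  linarith

/-- **`τ_int ≥ 1/√ā − 3/2` for balanced sign observables**, `ā = ∫∫ min(p(x)q(y), p(y)q(x))`
(`p = w/Z`) the equilibrium acceptance of the exact flow sampler (square-integrable weights;
`m² ≤ ā` by `overlap_sq_le_meanAccept`). -/
theorem imhOp_sign_tauInt_ge_of_meanAccept (hw0 : ∀ t, 0 < w t) (hwm : Measurable w)
    (hwi : Integrable w μ) (hq0 : ∀ t, 0 < q t) (hqm : Measurable q) (hqi : Integrable q μ)
    (hq1 : ∫ z, q z ∂μ = 1) (hW₂ : Integrable (fun x => w x / q x * w x) μ) {g : X → ℝ}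
    (hgm : Measurable g) (hg1 : ∀ t, g t ^ 2 = 1) (hg0 : ∫ x, g x * w x ∂μ = 0) :
    1 / Real.sqrt (∫ x, ∫ y, min (w x / (∫ z, w z ∂μ) * q y) (w y / (∫ z, w z ∂μ) * q x) ∂μ ∂μ)
        - 3 / 2
      ≤ tauInt (fun k => (∫ x, g x * ((imhOp μ w q)^[k] g) x * w x ∂μ)
          / ∫ x, g x ^ 2 * w x ∂μ) := by
  set Z : ℝ := ∫ z, w z ∂μ with hZdef
  have hZ : 0 < Z := integral_pos_of_pos hw0 hwi hq1
  have h1 := imhOp_sign_tauInt_ge_of_overlap hw0 hwm hwi hq0 hqm hqi hq1 hW₂ hgm hg1 hg0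
  obtain ⟨hmpos, -⟩ := overlap_inv_le hw0 hwi hq0 hqi hq1 hW₂
  rw [← hZdef] at h1 hmpos
  have hp0 : ∀ x, 0 ≤ w x / Z := fun x => (div_pos (hw0 x) hZ).le
  have hpm : Measurable fun x => w x / Z := hwm.div_const Z
  have hpi : Integrable (fun x => w x / Z) μ := hwi.div_const Z
  have hsq := overlap_sq_le_meanAccept hp0 hpm hpi (fun x => (hq0 x).le) hqm hqi hq1
  have hmle : ∫ x, min (w x / Z) (q x) ∂μ
      ≤ Real.sqrt (∫ x, ∫ y, min (w x / Z * q y) (w y / Z * q x) ∂μ ∂μ) := by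
    rw [← Real.sqrt_sq hmpos.le]
    exact Real.sqrt_le_sqrt hsq
  have : 1 / Real.sqrt (∫ x, ∫ y, min (w x / Z * q y) (w y / Z * q x) ∂μ ∂μ)
      ≤ 1 / ∫ x, min (w x / Z) (q x) ∂μ :=
    div_le_div_of_nonneg_left zero_le_one hmpos hmle
  linarith

/-! ## The lattice: row 2's φ⁴ flow sampler -/

section Lattice

variable {n : ℕ}

/-- **SIGN-OBSERVABLE SANDWICH FOR THE φ⁴ FLOW SAMPLER**: every `λ > 0`, real `J`, positive
measurable model density `q̃` with `∫ q̃ = 1` and `W₂ = ∫ (e^{−S}/q̃) e^{−S} < ∞`; for every bounded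
measurable `f` whose centred version `g = f − ⟨f⟩` satisfies `g² = 1`:
`W₂/Z² − ½ ≤ τ_int(f) ≤ ½ + 12 W₂/Z²` (`Z = ∫ e^{−S}`). -/
theorem phi4Flow_sign_tauInt_sandwich {lam : ℝ} (hlam : 0 < lam)
    (J : Fin (n + 1) → Fin (n + 1) → ℝ) {q : (Fin (n + 1) → ℝ) → ℝ} (hq0 : ∀ φ, 0 < q φ)
    (hqm : Measurable q) (hqi : Integrable q) (hq1 : ∫ φ, q φ = 1)
    (hW₂ : Integrable (fun φ => gibbsWeight J lam φ / q φ * gibbsWeight J lam φ))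
    {f : (Fin (n + 1) → ℝ) → ℝ} (hfm : Measurable f) {B : ℝ} (hfb : ∀ φ, |f φ| ≤ B)
    (hg1 : ∀ φ, (f φ - gibbsExpect J lam f) ^ 2 = 1) :
    (∫ φ, gibbsWeight J lam φ / q φ * gibbsWeight J lam φ) / (∫ φ, gibbsWeight J lam φ) ^ 2 - 1 / 2
      ≤ tauInt (fun k => (∫ φ, (f φ - gibbsExpect J lam f)
          * ((imhOpPhi4 J lam q)^[k] (fun ψ => f ψ - gibbsExpect J lam f)) φ * gibbsWeight J lam φ)
          / ∫ φ, (f φ - gibbsExpect J lam f) ^ 2 * gibbsWeight J lam φ)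
    ∧ tauInt (fun k => (∫ φ, (f φ - gibbsExpect J lam f)
          * ((imhOpPhi4 J lam q)^[k] (fun ψ => f ψ - gibbsExpect J lam f)) φ * gibbsWeight J lam φ)
          / ∫ φ, (f φ - gibbsExpect J lam f) ^ 2 * gibbsWeight J lam φ)
      ≤ 1 / 2 + 12 * (∫ φ, gibbsWeight J lam φ / q φ * gibbsWeight J lam φ)
          / (∫ φ, gibbsWeight J lam φ) ^ 2 := by
  obtain ⟨hgm, -, hg0⟩ := centred_observable hlam J hfm hfb
  rw [imhOpPhi4_eq_imhOp]
  exact imhOp_sign_tauInt_sandwich (μ := volume) (fun ψ => gibbsWeight_pos J lam ψ)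
    (continuous_gibbsWeight J lam).measurable (integrable_gibbsWeight hlam J) hq0 hqm hqi hq1
    hW₂ hgm hg1 hg0

end Lattice

end Summit.Ventures.LatticeQCDFlow.Exactness
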